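import Summits.NavierStokesRegularity.NavierStokesRegularity.Theses.AdaptedFrequency
import Literature.Analysis.FluidPDE.AdaptedBackwardKernel
import Literature.Analysis.FluidPDE.ClassicalSolution
import Literature.Analysis.FluidPDE.MildSolutionProofs
import Summits.NavierStokesRegularity.NavierStokesRegularity.Theorems.AdaptedFrequencyAdaptedFrequencyConvergesStubKernelCalculusCore
import HarnessLib

/-!
# Bernoulli–cloud identity I: whole-space integration by parts against a kernel slice for
# factors of linear growth — crux stmt-NavierStokesRegularity-10493
# (`AdaptedFrequency.AdaptedFrequencyConverges`), line cloud-frame-effective-tsai (lead c1 by-product)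

Helper file (`--supports stmt-NavierStokesRegularity-10493`, theorems only) for the
BERNOULLI–CLOUD IDENTITY `bernoulliCloud_hasDerivAt` (card lever 2 of the line): the two
boundary-free integrations by parts on the whole space `E` (a finite-dimensional real inner
product space with Lebesgue measure) that move derivatives from the kernel slice `g = G(t)` onto
the pressure `f = p(t)`, a function of **linear growth** `|f(x)| ≤ K (1 + ‖x‖)` with bounded
gradient (and bounded Laplacian):

* `cloudIBP_integral_mul_fderiv_apply`: `∫ f · Dg[v] = −∫ Df[v] · g` for a bounded
  divergence-free `C¹` drift `v`, provided `g ∈ L¹` and `(1 + ‖x‖) ‖Dg‖ ∈ L¹`;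
* `cloudIBP_integral_mul_laplacian`: `∫ f Δg = ∫ (Δf) g`, provided `g ∈ L¹` and
  `(1 + ‖x‖) |Δg| ∈ L¹`.

Proof (the standard truncation, Leray 1934 §6: spheres of radius `R → ∞`): apply the compactly
supported identities of the tree (`kernelCalculus_integral_mul_fderiv_apply`,
`kernelCalculus_integral_mul_laplacian`) to the cut-off products `f χ_R`, `χ_R = cutoff R`, and
let `R = n + 1 → ∞` by dominated convergence on both sides: the extra terms carry a derivative of
`χ_R`, which is `O(1/R)` (`O(1/R²)` for `Δχ_R`) and supported in `‖x‖ ≤ 2R`, so that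
`(1 + ‖x‖) ‖Dχ_R‖` and `(1 + ‖x‖) |Δχ_R|` are bounded uniformly in `R ≥ 1`
(`cloudIBP_cutoff_weight_bounds`) — exactly what absorbs the linear growth of `f`.
-/

noncomputable section

namespace Summit.NavierStokesRegularity.NavierStokesRegularity.Theorems.AdaptedFrequencyConverges.CloudFrameEffectiveTsai

open scoped Topology InnerProductSpace RealInnerProductSpace Laplacian ContDiff
open Literature.Analysis.FluidPDE Set Filter MeasureTheory Function Metric
open Summit.NavierStokesRegularity.NavierStokesRegularity.Theorems.AdaptedFrequencyConverges.TauberianOmegaLimit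

section General

variable {E : Type*} [NormedAddCommGroup E] [InnerProductSpace ℝ E] [FiniteDimensional ℝ E]

/-- **Weighted bounds for the derivatives of the cut-offs, uniform in `R ≥ 1`.** There is `C`
with `(1 + ‖x‖) ‖D(χ_R)(x)‖ ≤ C` and `(1 + ‖x‖) |Δ(χ_R)(x)| ≤ C` for all `R ≥ 1` and all `x`:
the derivatives are `O(1/R)` (tree: `exists_norm_fderiv_cutoff_le`,
`exists_abs_laplacian_cutoff_le`) and vanish off `‖x‖ ≤ 2R`, where `1 + ‖x‖ ≤ 3R`. -/
theorem cloudIBP_cutoff_weight_bounds :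
    ∃ C : ℝ, 0 ≤ C ∧ ∀ R : ℝ, 1 ≤ R → ∀ x : E,
      (1 + ‖x‖) * ‖fderiv ℝ (cutoff R) x‖ ≤ C ∧ (1 + ‖x‖) * |(Δ (cutoff R : E → ℝ)) x| ≤ C := by
  obtain ⟨C₁, hC₁0, hC₁⟩ := exists_norm_fderiv_cutoff_le (E := E)
  obtain ⟨C₂, hC₂0, hC₂⟩ := exists_abs_laplacian_cutoff_le (E := E)
  refine ⟨3 * (C₁ + C₂), by positivity, fun R hR x => ?_⟩
  have hR0 : 0 < R := one_pos.trans_le hR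
  by_cases hx : ‖x‖ ≤ 2 * R
  · have hw : 1 + ‖x‖ ≤ 3 * R := by linarith
    constructor
    · calc (1 + ‖x‖) * ‖fderiv ℝ (cutoff R) x‖ ≤ (3 * R) * (C₁ / R) :=
            mul_le_mul hw (hC₁ R hR0 x) (norm_nonneg _) (by positivity)
        _ = 3 * C₁ := by field_simp
        _ ≤ 3 * (C₁ + C₂) := by linarith
    · calc (1 + ‖x‖) * |(Δ (cutoff R : E → ℝ)) x| ≤ (3 * R) * (C₂ / R ^ 2) :=
            mul_le_mul hw (hC₂ R hR0 x) (abs_nonneg _) (by positivity)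
        _ = 3 * C₂ / R := by field_simp
        _ ≤ 3 * C₂ := div_le_self (by positivity) hR
        _ ≤ 3 * (C₁ + C₂) := by linarith
  · have hx' : x ∉ tsupport (cutoff (E := E) R) := fun h =>
      hx (mem_closedBall_zero_iff.1 (tsupport_cutoff_subset hR0 h))
    rw [fderiv_of_notMem_tsupport ℝ hx', laplacian_eq_zero_of_notMem_tsupport hx', norm_zero,
      abs_zero, mul_zero]
    exact ⟨by positivity, by positivity⟩

variable [MeasurableSpace E] [BorelSpace E]

/-- **Transport integration by parts on the whole space, linear growth against decay.** For
`f ∈ C¹` with `|f(x)| ≤ K(1 + ‖x‖)` and `‖Df‖ ≤ K`, `g ∈ C¹ ∩ L¹` with `(1 + ‖x‖)‖Dg‖ ∈ L¹`, and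
a divergence-free `C¹` drift `v` with `‖v‖ ≤ K`:  `∫ f · Dg[v] = −∫ Df[v] · g`
(`div (f g v) = g v·∇f + f v·∇g`; truncate with `χ_{n+1}` and let `n → ∞`). -/
theorem cloudIBP_integral_mul_fderiv_apply {f g : E → ℝ} {v : E → E} (hf : ContDiff ℝ 1 f)
    (hg : ContDiff ℝ 1 g) (hv : ContDiff ℝ 1 v) (hdiv : VectorCalculus.IsDivFree v) {K : ℝ}
    (hf0 : ∀ x, |f x| ≤ K * (1 + ‖x‖)) (hf1 : ∀ x, ‖fderiv ℝ f x‖ ≤ K) (hvK : ∀ x, ‖v x‖ ≤ K)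
    (hgi : Integrable g) (hDg : Integrable fun x => (1 + ‖x‖) * ‖fderiv ℝ g x‖) :
    ∫ x, f x * fderiv ℝ g x (v x) = -∫ x, fderiv ℝ f x (v x) * g x := by
  obtain ⟨C, hC0, hC⟩ := cloudIBP_cutoff_weight_bounds (E := E)
  have hK0 : 0 ≤ K := (norm_nonneg _).trans (hvK 0)
  have hR0 : ∀ n : ℕ, (0 : ℝ) < n + 1 := fun n => by positivity
  have hR1 : ∀ n : ℕ, (1 : ℝ) ≤ n + 1 := fun n => by
    have : (0 : ℝ) ≤ n := n.cast_nonneg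
    linarith
  -- the cut-off products `θ n = f χ_{n+1}`
  obtain ⟨θ, hθ⟩ : ∃ θ : ℕ → E → ℝ, θ = fun (n : ℕ) (y : E) => f y * cutoff ((n : ℝ) + 1) y :=
    ⟨_, rfl⟩
  have hθc : ∀ n, ContDiff ℝ 1 (θ n) := fun n => by rw [hθ]; exact hf.mul (contDiff_cutoff _)
  have hθs : ∀ n, HasCompactSupport (θ n) := fun n => by
    rw [hθ]; exact (hasCompactSupport_cutoff (hR0 n)).mul_left
  have hDθ : ∀ (n : ℕ) (x : E), fderiv ℝ (θ n) x (v x) = cutoff ((n : ℝ) + 1) x * fderiv ℝ f x (v x) +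
      f x * fderiv ℝ (cutoff ((n : ℝ) + 1)) x (v x) := fun n x => by
    rw [hθ, fderiv_fun_mul (hf.differentiable one_ne_zero x)
      ((contDiff_cutoff (n := 1) _).differentiable one_ne_zero x)]
    simp only [_root_.add_apply, _root_.FunLike.coe_smul, Pi.smul_apply, smul_eq_mul]
    ring
  -- the compactly supported identity for every `n`
  have hid : ∀ n : ℕ, ∫ x, cutoff ((n : ℝ) + 1) x * (f x * fderiv ℝ g x (v x)) =
      -∫ x, fderiv ℝ (θ n) x (v x) * g x := fun n => by
    rw [← kernelCalculus_integral_mul_fderiv_apply (hθc n) (hθs n) hg hv hdiv, hθ]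
    exact integral_congr_ae (Eventually.of_forall fun x => by ring)
  -- continuity facts
  have hfc : Continuous f := hf.continuous
  have hDfc : Continuous fun x => fderiv ℝ f x (v x) :=
    (hf.continuous_fderiv one_ne_zero).clm_apply hv.continuous
  have hDgc : Continuous fun x => fderiv ℝ g x (v x) :=
    (hg.continuous_fderiv one_ne_zero).clm_apply hv.continuous
  -- the left-hand side: `∫ χ_{n+1} (f Dg[v]) → ∫ f Dg[v]`
  have hLi : Integrable fun x => f x * fderiv ℝ g x (v x) := by
    refine (hDg.const_mul (K * K)).mono' (hfc.mul hDgc).aestronglyMeasurable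
      (Eventually.of_forall fun x => ?_)
    rw [norm_mul, Real.norm_eq_abs, Real.norm_eq_abs]
    calc |f x| * |fderiv ℝ g x (v x)| ≤ (K * (1 + ‖x‖)) * (‖fderiv ℝ g x‖ * K) := by
          refine mul_le_mul (hf0 x) ?_ (abs_nonneg _) (by positivity)
          rw [← Real.norm_eq_abs]
          exact (ContinuousLinearMap.le_opNorm _ _).trans (by gcongr; exact hvK x)
      _ = K * K * ((1 + ‖x‖) * ‖fderiv ℝ g x‖) := by ring
  have hL := tendsto_integral_cutoff_mul hLi
  -- the right-hand side: `∫ Dθ_n[v] g → ∫ Df[v] g` by dominated convergence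
  have hR : Tendsto (fun n : ℕ => ∫ x, fderiv ℝ (θ n) x (v x) * g x) atTop
      (𝓝 (∫ x, fderiv ℝ f x (v x) * g x)) := by
    refine tendsto_integral_of_dominated_convergence (fun x => (K * K + K * C * K) * ‖g x‖)
      (fun n => ?_) (hgi.norm.const_mul _) (fun n => Eventually.of_forall fun x => ?_)
      (Eventually.of_forall fun x => ?_)
    · exact ((((hθc n).continuous_fderiv one_ne_zero).clm_apply hv.continuous).mul
        hg.continuous).aestronglyMeasurable
    · rw [norm_mul, hDθ n x, Real.norm_eq_abs]
      refine mul_le_mul_of_nonneg_right ?_ (norm_nonneg _)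
      have h1 : |cutoff ((n : ℝ) + 1) x * fderiv ℝ f x (v x)| ≤ K * K := by
        rw [abs_mul]
        calc |cutoff ((n : ℝ) + 1) x| * |fderiv ℝ f x (v x)| ≤ 1 * (K * K) := by
              refine mul_le_mul (abs_cutoff_le_one _ _) ?_ (abs_nonneg _) zero_le_one
              rw [← Real.norm_eq_abs]
              exact (ContinuousLinearMap.le_opNorm _ _).trans
                (mul_le_mul (hf1 x) (hvK x) (norm_nonneg _) hK0)
          _ = K * K := one_mul _
      have h2 : |f x * fderiv ℝ (cutoff ((n : ℝ) + 1)) x (v x)| ≤ K * C * K := by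
        rw [abs_mul]
        calc |f x| * |fderiv ℝ (cutoff ((n : ℝ) + 1)) x (v x)|
            ≤ (K * (1 + ‖x‖)) * (‖fderiv ℝ (cutoff ((n : ℝ) + 1)) x‖ * K) := by
              refine mul_le_mul (hf0 x) ?_ (abs_nonneg _) (by positivity)
              rw [← Real.norm_eq_abs]
              exact (ContinuousLinearMap.le_opNorm _ _).trans (by gcongr; exact hvK x)
          _ = K * ((1 + ‖x‖) * ‖fderiv ℝ (cutoff ((n : ℝ) + 1)) x‖) * K := by ring
          _ ≤ K * C * K := by gcongr; exact (hC _ (hR1 n) x).1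
      exact (abs_add_le _ _).trans (add_le_add h1 h2)
    · refine tendsto_const_nhds.congr' ?_
      filter_upwards [eventually_gt_atTop ⌈‖x‖⌉₊] with n hn
      have hxn : ‖x‖ < (n : ℝ) + 1 := by
        have h1 : (⌈‖x‖⌉₊ : ℝ) < n := by exact_mod_cast hn
        linarith [Nat.le_ceil ‖x‖]
      rw [hDθ n x, fderiv_cutoff_eq_zero (hR0 n) hxn, cutoff_eq_one (hR0 n) hxn.le]
      simp
  exact tendsto_nhds_unique hL (hR.neg.congr fun n => (hid n).symm)

/-- **Green's second identity on the whole space, linear growth against decay.** For `f ∈ C²`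
with `|f(x)| ≤ K(1 + ‖x‖)`, `‖Df‖ ≤ K`, `|Δf| ≤ K`, and `g ∈ C² ∩ L¹` with `(1 + ‖x‖)|Δg| ∈ L¹`:
`∫ f Δg = ∫ (Δf) g` (truncate with `χ_{n+1}`, use
`Δ(f χ) = f Δχ + 2 Σᵢ ∂ᵢf ∂ᵢχ + (Δf) χ`, and let `n → ∞`). No second-derivative bound on `f`
beyond `Δf` is needed. -/
theorem cloudIBP_integral_mul_laplacian {f g : E → ℝ} (hf : ContDiff ℝ 2 f) (hg : ContDiff ℝ 2 g)
    {K : ℝ} (hf0 : ∀ x, |f x| ≤ K * (1 + ‖x‖)) (hf1 : ∀ x, ‖fderiv ℝ f x‖ ≤ K)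
    (hf2 : ∀ x, |(Δ f) x| ≤ K) (hgi : Integrable g)
    (hΔg : Integrable fun x => (1 + ‖x‖) * |(Δ g) x|) :
    ∫ x, f x * (Δ g) x = ∫ x, (Δ f) x * g x := by
  obtain ⟨C, hC0, hC⟩ := cloudIBP_cutoff_weight_bounds (E := E)
  have hK0 : 0 ≤ K := (norm_nonneg _).trans (hf1 0)
  have hR0 : ∀ n : ℕ, (0 : ℝ) < n + 1 := fun n => by positivity
  have hR1 : ∀ n : ℕ, (1 : ℝ) ≤ n + 1 := fun n => by
    have : (0 : ℝ) ≤ n := n.cast_nonneg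
    linarith
  set b := stdOrthonormalBasis ℝ E
  -- the cut-off products `θ n = f χ_{n+1}`
  obtain ⟨θ, hθ⟩ : ∃ θ : ℕ → E → ℝ, θ = fun (n : ℕ) (y : E) => f y * cutoff ((n : ℝ) + 1) y :=
    ⟨_, rfl⟩
  have hθc : ∀ n, ContDiff ℝ 2 (θ n) := fun n => by rw [hθ]; exact hf.mul (contDiff_cutoff _)
  have hθs : ∀ n, HasCompactSupport (θ n) := fun n => by
    rw [hθ]; exact (hasCompactSupport_cutoff (hR0 n)).mul_left
  have hΔθ : ∀ (n : ℕ) (x : E), (Δ (θ n)) x = f x * (Δ (cutoff ((n : ℝ) + 1) : E → ℝ)) x +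
      2 * ∑ i, fderiv ℝ f x (b i) * fderiv ℝ (cutoff ((n : ℝ) + 1)) x (b i) +
      (Δ f) x * cutoff ((n : ℝ) + 1) x := fun n x => by
    have h := laplacian_smul_apply (Ψ := cutoff ((n : ℝ) + 1)) hf (contDiff_cutoff _) x
    simp only [smul_eq_mul] at h
    rw [hθ]
    exact h
  -- the compactly supported identity for every `n`
  have hid : ∀ n : ℕ, ∫ x, cutoff ((n : ℝ) + 1) x * (f x * (Δ g) x) =
      ∫ x, (Δ (θ n)) x * g x := fun n => by
    rw [← kernelCalculus_integral_mul_laplacian (hθc n) (hθs n) hg, hθ]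
    exact integral_congr_ae (Eventually.of_forall fun x => by ring)
  -- the left-hand side
  have hLi : Integrable fun x => f x * (Δ g) x := by
    refine (hΔg.const_mul K).mono' (hf.continuous.mul (continuous_laplacian hg)).aestronglyMeasurable
      (Eventually.of_forall fun x => ?_)
    rw [norm_mul, Real.norm_eq_abs, Real.norm_eq_abs]
    calc |f x| * |(Δ g) x| ≤ (K * (1 + ‖x‖)) * |(Δ g) x| :=
          mul_le_mul_of_nonneg_right (hf0 x) (abs_nonneg _)
      _ = K * ((1 + ‖x‖) * |(Δ g) x|) := by ring
  have hL := tendsto_integral_cutoff_mul hLi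
  -- the right-hand side by dominated convergence
  have hR : Tendsto (fun n : ℕ => ∫ x, (Δ (θ n)) x * g x) atTop (𝓝 (∫ x, (Δ f) x * g x)) := by
    refine tendsto_integral_of_dominated_convergence
      (fun x => (K * C + 2 * (Fintype.card (Fin (Module.finrank ℝ E)) * (K * C)) + K) * ‖g x‖)
      (fun n => ?_) (hgi.norm.const_mul _) (fun n => Eventually.of_forall fun x => ?_)
      (Eventually.of_forall fun x => ?_)
    · exact ((continuous_laplacian (hθc n)).mul hg.continuous).aestronglyMeasurable
    · rw [norm_mul, hΔθ n x, Real.norm_eq_abs]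
      refine mul_le_mul_of_nonneg_right ?_ (norm_nonneg _)
      have h1 : |f x * (Δ (cutoff ((n : ℝ) + 1) : E → ℝ)) x| ≤ K * C := by
        rw [abs_mul]
        calc |f x| * |(Δ (cutoff ((n : ℝ) + 1) : E → ℝ)) x|
            ≤ (K * (1 + ‖x‖)) * |(Δ (cutoff ((n : ℝ) + 1) : E → ℝ)) x| :=
              mul_le_mul_of_nonneg_right (hf0 x) (abs_nonneg _)
          _ = K * ((1 + ‖x‖) * |(Δ (cutoff ((n : ℝ) + 1) : E → ℝ)) x|) := by ring
          _ ≤ K * C := by gcongr; exact (hC _ (hR1 n) x).2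
      have h2 : |2 * ∑ i, fderiv ℝ f x (b i) * fderiv ℝ (cutoff ((n : ℝ) + 1)) x (b i)| ≤
          2 * (Fintype.card (Fin (Module.finrank ℝ E)) * (K * C)) := by
        rw [abs_mul, abs_two]
        refine mul_le_mul_of_nonneg_left ((Finset.abs_sum_le_sum_abs _ _).trans ?_) zero_le_two
        have hterm : ∀ i, |fderiv ℝ f x (b i) * fderiv ℝ (cutoff ((n : ℝ) + 1)) x (b i)| ≤
            K * C := fun i => by
          rw [abs_mul]
          have ha : |fderiv ℝ f x (b i)| ≤ K := by
            rw [← Real.norm_eq_abs]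
            refine (ContinuousLinearMap.le_opNorm _ _).trans ?_
            rw [b.orthonormal.1 i, mul_one]
            exact hf1 x
          have hb : |fderiv ℝ (cutoff ((n : ℝ) + 1)) x (b i)| ≤ C := by
            rw [← Real.norm_eq_abs]
            refine (ContinuousLinearMap.le_opNorm _ _).trans ?_
            rw [b.orthonormal.1 i, mul_one]
            calc ‖fderiv ℝ (cutoff ((n : ℝ) + 1)) x‖
                ≤ (1 + ‖x‖) * ‖fderiv ℝ (cutoff ((n : ℝ) + 1)) x‖ :=
                  le_mul_of_one_le_left (norm_nonneg _) (by linarith [norm_nonneg x])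
              _ ≤ C := (hC _ (hR1 n) x).1
          exact mul_le_mul ha hb (abs_nonneg _) hK0
        refine (Finset.sum_le_sum fun i _ => hterm i).trans ?_
        rw [Finset.sum_const, Finset.card_univ, nsmul_eq_mul]
      have h3 : |(Δ f) x * cutoff ((n : ℝ) + 1) x| ≤ K := by
        rw [abs_mul]
        calc |(Δ f) x| * |cutoff ((n : ℝ) + 1) x| ≤ K * 1 :=
              mul_le_mul (hf2 x) (abs_cutoff_le_one _ _) (abs_nonneg _) hK0
          _ = K := mul_one K
      calc _ ≤ |f x * (Δ (cutoff ((n : ℝ) + 1) : E → ℝ)) x +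
            2 * ∑ i, fderiv ℝ f x (b i) * fderiv ℝ (cutoff ((n : ℝ) + 1)) x (b i)| +
            |(Δ f) x * cutoff ((n : ℝ) + 1) x| := abs_add_le _ _
        _ ≤ |f x * (Δ (cutoff ((n : ℝ) + 1) : E → ℝ)) x| +
            |2 * ∑ i, fderiv ℝ f x (b i) * fderiv ℝ (cutoff ((n : ℝ) + 1)) x (b i)| +
            |(Δ f) x * cutoff ((n : ℝ) + 1) x| := by gcongr; exact abs_add_le _ _
        _ ≤ K * C + 2 * (Fintype.card (Fin (Module.finrank ℝ E)) * (K * C)) + K := by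
            linarith
    · refine tendsto_const_nhds.congr' ?_
      filter_upwards [eventually_gt_atTop ⌈‖x‖⌉₊] with n hn
      have hxn : ‖x‖ < (n : ℝ) + 1 := by
        have h1 : (⌈‖x‖⌉₊ : ℝ) < n := by exact_mod_cast hn
        linarith [Nat.le_ceil ‖x‖]
      rw [hθ, (kernelCalculus_cutoffProduct_eq (f := f) (hR0 n) hxn).2.2]
  exact tendsto_nhds_unique hL (hR.congr fun n => (hid n).symm)

end General

end Summit.NavierStokesRegularity.NavierStokesRegularity.Theorems.AdaptedFrequencyConverges.CloudFrameEffectiveTsai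

end
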